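import Summits.ValiantsHypothesis.ValiantsHypothesis.Theorems.RefutationDegreeMrCalibrationMinors
import Literature.Computability.AlgebraicComplexity.DeterminantIrreducible
import Mathlib.Algebra.MvPolynomial.NoZeroDivisors
import Mathlib.RingTheory.Localization.FractionRing

/-!
# Route `RefutationDegree`, item `MrCalibration` (stmt-ValiantsHypothesis-5647) — the Hessian
# minors of `det A(x)` at a point are multiples of `det A(y)`

Helper file (no definitions). Let `A(x) = A₀ + Σ_e x_e A_e` be the generic pencil of `m × m`
matrices in the `n²` variables `x_e` (`e ∈ [n] × [n]`), whose `(n² + 1) m²` entries are the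
unknowns `a = (X (none, (i,j)), X (some e, (i,j)))` of the system `Rep(n,m)`; so `det A(x)` is a
polynomial in `x` over `R = ℂ[a]`. For a point `y ∈ ℂ^{n × n}` write `B = A(y) ∈ R^{m × m}` and
`H = H(det A(X + y))(0) ∈ R^{n² × n²}` for the Hessian of `det A(x)` at `y` (`hess0 ∘ transl` of
`HessianAtOrigin.lean`, over the coefficient ring `R`). Main result (`det_evalA_dvd_minor`):

  every `k × k` minor of `H` with `k > 2m` is divisible by `det B` in `R`.

Proof. `det B` is a prime of `R` (`prime_det_evalA`): the `ℂ`-algebra automorphism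
`X (none, ij) ↦ X (none, ij) + Σ_e y_e X (some e, ij)` of `R` carries the determinant of the matrix
of distinct variables `(X (none, ij))`, prime by `prime_det_of_X` (`DeterminantIrreducible.lean`),
to `det B`. Over the field `K = Frac(R/(det B))` the image of `A(X + y)` is a matrix of affine
linear forms whose determinant vanishes at the origin, so by the rank half of Mignon–Ressayre's
argument (`rank_hess0_det_le`, `MignonRessayreBound.lean`) its Hessian at the origin — the image
of `H` — has rank `≤ 2m`; hence the `k × k` minors of `H` vanish in `K`, i.e. lie in `(det B)`.
Also here: the normal form of the entries of `A(X + y)` (`transl_genA_apply`), the degree bounds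
`deg_a coeff_μ det A(X + y) ≤ m` and `deg H_{ef} ≤ m` (`coeffDeg_det_transl_genA`,
`totalDegree_hessD_le`), `deg det B = m` (`totalDegree_det_evalA`), and the quotient with its
degree, `minor = det B · Q`, `deg Q ≤ 2m²` (`exists_minor_eq_det_evalA_mul`).

References: T. Mignon, N. Ressayre, *A quadratic bound for the determinant and permanent problem*,
IMRN 2004, Thm. 1.1 and §2; J. M. Landsberg, *Geometry and Complexity Theory* (2017), §6.4.5;
N. Jacobson, *Basic Algebra I*, §7.2 (primality of the generic determinant).
-/

noncomputable section

-- single-conjunct layout: Sub = Summit, duplicated namespace component intended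
set_option linter.dupNamespace false

namespace Summit.ValiantsHypothesis.ValiantsHypothesis.Theorems.RefutationDegreeMrCalibration

open MvPolynomial Matrix Literature.Computability.AlgebraicComplexity

section Divides

variable {n m : ℕ}

/-- The generic pencil `A(x) = A₀ + Σ_e x_e A_e` with unknown entries (local notation; the item's
statement inlines it). -/
local notation3 (prettyPrint := false) "genA[" n ", " m "]" => (Matrix.of fun i j : Fin m =>
    MvPolynomial.C (MvPolynomial.X (none, (i, j))) +
      ∑ e : Fin n × Fin n, MvPolynomial.X e * MvPolynomial.C (MvPolynomial.X (some e, (i, j))) :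
  Matrix (Fin m) (Fin m) (MvPolynomial (Fin n × Fin n)
    (MvPolynomial (Option (Fin n × Fin n) × (Fin m × Fin m)) ℂ)))

/-- The value `B = A(y)` of the pencil at a point `y` (local notation). -/
local notation3 (prettyPrint := false) "evalA[" n ", " m ", " y "]" => (Matrix.of fun i j : Fin m =>
    MvPolynomial.X (none, (i, j)) +
      ∑ e : Fin n × Fin n, MvPolynomial.C (y e) * MvPolynomial.X (some e, (i, j)) :
  Matrix (Fin m) (Fin m) (MvPolynomial (Option (Fin n × Fin n) × (Fin m × Fin m)) ℂ))

/-- The point `y` with coordinates read in the coefficient ring `R = ℂ[a]` (local notation). -/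
local notation3 (prettyPrint := false) "Cpt[" n ", " m ", " y "]" => (fun e : Fin n × Fin n =>
  (MvPolynomial.C (y e) : MvPolynomial (Option (Fin n × Fin n) × (Fin m × Fin m)) ℂ))

/-- The entries of the translated pencil `A(X + y)` in normal form:
`C (B i j) + Σ_e X_e · C (a_{e,ij})`. [folklore] -/
theorem transl_genA_apply (y : Fin n × Fin n → ℂ) (i j : Fin m) :
    transl Cpt[n, m, y] (genA[n, m] i j) =
      C (evalA[n, m, y] i j) + ∑ e : Fin n × Fin n, X e * C (X (some e, (i, j))) := by
  simp only [Matrix.of_apply, map_add, map_sum, map_mul, transl_C, transl_X, add_mul,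
    Finset.sum_add_distrib]
  ring

/-- The value of `det A(x)` at the point `y` (coordinates in `R`) is `det B`. [folklore] -/
theorem eval_genA_det (y : Fin n × Fin n → ℂ) :
    eval Cpt[n, m, y] (genA[n, m]).det = (evalA[n, m, y]).det := by
  rw [RingHom.map_det, RingHom.mapMatrix_apply]
  congr 1
  ext i j
  simp [Matrix.map_apply, Matrix.of_apply, eval_C, eval_X, map_add, map_sum, map_mul]

/-- The constant term of `det A(X + y)` is `det B`. [folklore] -/
theorem constantCoeff_det_transl_genA (y : Fin n × Fin n → ℂ) :
    constantCoeff ((transl Cpt[n, m, y]).mapMatrix genA[n, m]).det = (evalA[n, m, y]).det := by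
  rw [← AlgHom.map_det, constantCoeff_transl, eval_genA_det]

/-- The entries of `B = A(y)` have degree `≤ 1`. [folklore] -/
theorem totalDegree_evalA_le (y : Fin n × Fin n → ℂ) (i j : Fin m) :
    (evalA[n, m, y] i j).totalDegree ≤ 1 := by
  rw [Matrix.of_apply]
  refine (totalDegree_add _ _).trans (max_le ((totalDegree_X _).le) ?_)
  refine totalDegree_finsetSum_le fun e _ => (totalDegree_mul _ _).trans ?_
  rw [totalDegree_C, zero_add]
  exact (totalDegree_X _).le

/-- The `x`-coefficients of `det A(X + y)` have degree `≤ m` in the unknowns. [folklore] -/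
theorem coeffDeg_det_transl_genA (y : Fin n × Fin n → ℂ) (μ : Fin n × Fin n →₀ ℕ) :
    (coeff μ ((transl Cpt[n, m, y]).mapMatrix genA[n, m]).det).totalDegree ≤ m := by
  have h := coeffDeg_det ((transl Cpt[n, m, y]).mapMatrix genA[n, m]) (d := 1) (fun i j ν => ?_) μ
  · simpa using h
  rw [AlgHom.mapMatrix_apply, Matrix.map_apply, transl_genA_apply]
  refine coeffDeg_add (coeffDeg_C _ (totalDegree_evalA_le y i j)) (fun ν' => ?_) ν
  exact coeffDeg_sum _ _ (fun e _ ν'' => coeffDeg_X_mul_C e _ ((totalDegree_X _).le) ν'') ν'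

/-- The `x`-coefficients of `det A(x)` have degree `≤ m` in the unknowns. [folklore] -/
theorem coeffDeg_det_genA (μ : Fin n × Fin n →₀ ℕ) :
    (coeff μ (genA[n, m]).det).totalDegree ≤ m := by
  have h := coeffDeg_det genA[n, m] (d := 1) (fun i j ν => ?_) μ
  · simpa using h
  rw [Matrix.of_apply]
  refine coeffDeg_add (coeffDeg_C _ ((totalDegree_X _).le)) (fun ν' => ?_) ν
  exact coeffDeg_sum _ _ (fun e _ ν'' => coeffDeg_X_mul_C e _ ((totalDegree_X _).le) ν'') ν'

/-- The entries of the Hessian `H = H(det A(X + y))(0)` have degree `≤ m` in the unknowns.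
[folklore] -/
theorem totalDegree_hessD_le (y : Fin n × Fin n → ℂ) (e f : Fin n × Fin n) :
    (hess0 (transl Cpt[n, m, y] (genA[n, m]).det) e f).totalDegree ≤ m := by
  rw [AlgHom.map_det]
  exact totalDegree_hess0_apply_le _ e f (coeffDeg_det_transl_genA y)

/-- `det B` is homogeneous of degree `m` in the unknowns. [folklore] -/
theorem isHomogeneous_det_evalA (y : Fin n × Fin n → ℂ) :
    (evalA[n, m, y]).det.IsHomogeneous m := by
  have h := isHomogeneous_det evalA[n, m, y] (d := 1) (fun i j => ?_)
  · simpa using h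
  rw [Matrix.of_apply]
  refine (isHomogeneous_X _ _).add (IsHomogeneous.sum _ _ _ fun e _ => ?_)
  simpa using (isHomogeneous_C _ (y e)).mul (isHomogeneous_X ℂ (some e, (i, j)))

/-- **`det B` is prime** in `R = ℂ[a]` (`m ≥ 1`): it is the image of the determinant of the matrix
of distinct variables `(X (none, ij))`, prime by `prime_det_of_X`, under the `ℂ`-algebra
automorphism `X (none, ij) ↦ X (none, ij) + Σ_e y_e X (some e, ij)` of `R`. [folklore] -/
theorem prime_det_evalA (hm : 0 < m) (y : Fin n × Fin n → ℂ) : Prime (evalA[n, m, y]).det := by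
  classical
  haveI : Nonempty (Fin m) := ⟨⟨0, hm⟩⟩
  -- the automorphism and its inverse
  let g₁ : Option (Fin n × Fin n) × (Fin m × Fin m) →
      MvPolynomial (Option (Fin n × Fin n) × (Fin m × Fin m)) ℂ := fun v =>
    X v + Option.elim v.1 (∑ e : Fin n × Fin n, C (y e) * X (some e, v.2)) (fun _ => 0)
  let g₂ : Option (Fin n × Fin n) × (Fin m × Fin m) →
      MvPolynomial (Option (Fin n × Fin n) × (Fin m × Fin m)) ℂ := fun v =>
    X v - Option.elim v.1 (∑ e : Fin n × Fin n, C (y e) * X (some e, v.2)) (fun _ => 0)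
  have h12 : (aeval g₁).comp (aeval g₂) = AlgHom.id ℂ _ := by
    refine algHom_ext fun v => ?_
    obtain ⟨_ | e, ij⟩ := v
    · simp [g₁, g₂, map_sum]
    · simp [g₁, g₂]
  have h21 : (aeval g₂).comp (aeval g₁) = AlgHom.id ℂ _ := by
    refine algHom_ext fun v => ?_
    obtain ⟨_ | e, ij⟩ := v
    · simp [g₁, g₂, map_sum]
    · simp [g₁, g₂]
  let θ : MvPolynomial (Option (Fin n × Fin n) × (Fin m × Fin m)) ℂ ≃ₐ[ℂ]
      MvPolynomial (Option (Fin n × Fin n) × (Fin m × Fin m)) ℂ :=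
    AlgEquiv.ofAlgHom (aeval g₁) (aeval g₂) h12 h21
  have hι : Function.Injective
      (fun ij : Fin m × Fin m => ((none : Option (Fin n × Fin n)), ij)) :=
    fun a b h => by simpa using h
  have hprime := prime_det_of_X (k := ℂ) hι
  rw [← MulEquiv.prime_iff θ.toMulEquiv] at hprime
  convert hprime using 1
  show _ = θ (Matrix.of fun i j : Fin m =>
    (X (none, (i, j)) : MvPolynomial (Option (Fin n × Fin n) × (Fin m × Fin m)) ℂ)).det
  rw [AlgEquiv.map_det]
  congr 1
  ext i j
  simp [θ, g₁, AlgEquiv.mapMatrix_apply, Matrix.map_apply]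

/-- `det B` has total degree `m`. [folklore] -/
theorem totalDegree_det_evalA (y : Fin n × Fin n → ℂ) : (evalA[n, m, y]).det.totalDegree = m := by
  rcases Nat.eq_zero_or_pos m with rfl | hm
  · rw [Matrix.det_isEmpty, totalDegree_one]
  · exact (isHomogeneous_det_evalA y).totalDegree (prime_det_evalA hm y).ne_zero

/-- **The Hessian minors are multiples of `det B`.** For every point `y` and `k > 2m`, every
`k × k` minor of the Hessian `H(det A(X + y))(0)` (a matrix over `R = ℂ[a]`) is divisible by
`det B = det A(y)`: over `K = Frac(R / (det B))` (a field, `det B` being prime) the pencil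
`A(X + y)` has affine entries and singular constant term, so its Hessian at the origin has rank
`≤ 2m` (`rank_hess0_det_le`, Mignon–Ressayre 2004, §2 / Landsberg 2017, §6.4.5), and the minor
vanishes in `K`. [cite: MignonRessayre2004, Thm. 1.1] -/
theorem det_evalA_dvd_minor (y : Fin n × Fin n → ℂ) {k : ℕ} (hk : 2 * m < k)
    (r c : Fin k → Fin n × Fin n) :
    (evalA[n, m, y]).det ∣ ((hess0 (transl Cpt[n, m, y] (genA[n, m]).det)).submatrix r c).det := by
  classical
  rcases Nat.eq_zero_or_pos m with rfl | hm
  · -- `m = 0`: the determinant is the constant `1`, its Hessian vanishes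
    have h0 : hess0 (transl Cpt[n, 0, y] (genA[n, 0]).det) = 0 := by
      rw [Matrix.det_isEmpty, map_one]
      exact hess0_eq_zero_of_totalDegree_le_one (by rw [totalDegree_one]; exact zero_le_one)
    haveI hk' : Nonempty (Fin k) := ⟨⟨0, by omega⟩⟩
    have hsub0 : (0 : Matrix (Fin n × Fin n) (Fin n × Fin n)
        (MvPolynomial (Option (Fin n × Fin n) × (Fin 0 × Fin 0)) ℂ)).submatrix r c =
        (0 : Matrix (Fin k) (Fin k) (MvPolynomial (Option (Fin n × Fin n) × (Fin 0 × Fin 0)) ℂ)) :=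
      rfl
    rw [h0, hsub0, Matrix.det_zero]
    exact dvd_zero _
  -- notation
  set B := evalA[n, m, y] with hB
  set A := genA[n, m] with hA
  have hprime : Prime B.det := prime_det_evalA hm y
  let 𝔮 : Ideal (MvPolynomial (Option (Fin n × Fin n) × (Fin m × Fin m)) ℂ) := Ideal.span {B.det}
  haveI h𝔮 : 𝔮.IsPrime := (Ideal.span_singleton_prime hprime.ne_zero).mpr hprime
  let φ : MvPolynomial (Option (Fin n × Fin n) × (Fin m × Fin m)) ℂ →+*
      FractionRing (MvPolynomial (Option (Fin n × Fin n) × (Fin m × Fin m)) ℂ ⧸ 𝔮) :=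
    (algebraMap _ _).comp (Ideal.Quotient.mk 𝔮)
  have hφ0 : φ B.det = 0 := by
    have : Ideal.Quotient.mk 𝔮 B.det = 0 :=
      Ideal.Quotient.eq_zero_iff_mem.mpr (Ideal.mem_span_singleton_self _)
    simp [φ, this]
  have hφker : ∀ f, φ f = 0 → B.det ∣ f := fun f hf => by
    have h1 : Ideal.Quotient.mk 𝔮 f = 0 := by
      apply IsFractionRing.injective (MvPolynomial (Option (Fin n × Fin n) × (Fin m × Fin m)) ℂ ⧸ 𝔮)
        (FractionRing (MvPolynomial (Option (Fin n × Fin n) × (Fin m × Fin m)) ℂ ⧸ 𝔮))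
      rw [map_zero]
      exact hf
    exact Ideal.mem_span_singleton.mp (Ideal.Quotient.eq_zero_iff_mem.mp h1)
  -- the pencil over `K`
  set A' := (transl Cpt[n, m, y]).mapMatrix A with hA'
  set AK := A'.map (MvPolynomial.map φ) with hAK
  have hdeg : ∀ i j, (AK i j).totalDegree ≤ 1 := by
    intro i j
    rw [hAK, Matrix.map_apply, hA', AlgHom.mapMatrix_apply, Matrix.map_apply, hA,
      transl_genA_apply, map_add, map_C, map_sum]
    refine (totalDegree_add _ _).trans (max_le ((totalDegree_C _).trans_le (Nat.zero_le _)) ?_)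
    refine totalDegree_finsetSum_le fun e _ => ?_
    rw [map_mul, map_X, map_C]
    refine (totalDegree_mul _ _).trans ?_
    rw [totalDegree_C, add_zero]
    exact (totalDegree_X _).le
  have h0 : constantCoeff AK.det = 0 := by
    rw [hAK, ← RingHom.mapMatrix_apply, ← RingHom.map_det, constantCoeff_map, hA', hA,
      constantCoeff_det_transl_genA, ← hB, hφ0]
  have hrank := rank_hess0_det_le AK hdeg h0
  have hHess : hess0 AK.det = (hess0 (transl Cpt[n, m, y] A.det)).map φ := by
    rw [hAK, ← RingHom.mapMatrix_apply, ← RingHom.map_det, hess0_map, hA', ← AlgHom.map_det]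
  apply hφker
  rw [RingHom.map_det, RingHom.mapMatrix_apply]
  have hsub : ((hess0 (transl Cpt[n, m, y] A.det)).submatrix r c).map φ =
      ((hess0 (transl Cpt[n, m, y] A.det)).map φ).submatrix r c := rfl
  rw [hsub, ← hHess]
  exact det_submatrix_eq_zero_of_rank_lt _ (lt_of_le_of_lt hrank hk) r c

/-- **The quotient and its degree.** For a `(2m+1) × (2m+1)` minor `M_D` of the Hessian
`H(det A(X + y))(0)`: `M_D = det B · Q` with `deg Q ≤ 2m²` (the entries of `H` have degree `≤ m`,
`deg det B = m`, and degrees add in the domain `R`). [folklore] -/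
theorem exists_minor_eq_det_evalA_mul (y : Fin n × Fin n → ℂ)
    (r c : Fin (2 * m + 1) → Fin n × Fin n) :
    ∃ Q : MvPolynomial (Option (Fin n × Fin n) × (Fin m × Fin m)) ℂ,
      Q.totalDegree ≤ 2 * m * m ∧
      ((hess0 (transl Cpt[n, m, y] (genA[n, m]).det)).submatrix r c).det =
        (evalA[n, m, y]).det * Q := by
  obtain ⟨Q, hQ⟩ := det_evalA_dvd_minor y (Nat.lt_succ_self _) r c
  by_cases hQ0 : Q = 0
  · exact ⟨0, by rw [totalDegree_zero]; exact Nat.zero_le _, by rw [hQ, hQ0]⟩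
  refine ⟨Q, ?_, hQ⟩
  have hdet0 : (evalA[n, m, y]).det ≠ 0 := fun h => by
    have := totalDegree_det_evalA (n := n) (m := m) y
    rw [h, totalDegree_zero] at this
    subst this
    rw [Matrix.det_isEmpty] at h
    exact one_ne_zero h
  have h1 : ((hess0 (transl Cpt[n, m, y] (genA[n, m]).det)).submatrix r c).det.totalDegree ≤
      (2 * m + 1) * m := by
    have := totalDegree_det_le ((hess0 (transl Cpt[n, m, y] (genA[n, m]).det)).submatrix r c)
      (d := m) fun i j => totalDegree_hessD_le y _ _
    simpa using this
  rw [hQ, totalDegree_mul_of_isDomain hdet0 hQ0, totalDegree_det_evalA] at h1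
  nlinarith [h1]

end Divides

end Summit.ValiantsHypothesis.ValiantsHypothesis.Theorems.RefutationDegreeMrCalibration
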